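import Summits.BirchSwinnertonDyer.BirchSwinnertonDyer.Theorems.KimAtThreeDeepUpperTowerLattice
import Summits.BirchSwinnertonDyer.BirchSwinnertonDyer.Theorems.KimAtThreeDeepLowerKatoPartsCrux
import HarnessLib

/-!
# Crux `DeepUpperAtThree` (19076) — and item 20013, `N11.KimAtThreeDeepPUB` — BY NAME from the cite leaves, (S5a),
# (S5b-tower) and the ONE Kato-side statement hKatoV2ᵘ (route `KimAtThreeKolyvagin`, rung W2; cell `bsd-addord`,
# seat w2-c3 gen 8)

HONEST FRAMING. Glue theorems only; CONDITIONAL on displayed hypotheses; nothing is closed or booked; BSD is not proved by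
any of this. w2-c2 g9's `KimAtThreeDeepLowerKatoPartsCrux` (p515646) concludes the deep decls of W2 BY NAME from the four
cite leaves, (S5a), hKatoV2ᵘ and the displayed lattice bound hLatᵘ; `KimAtThreeDeepUpperTowerLattice.hLat_of_facts`
(this seat) PROVES hLatᵘ from the cite fact (S5b-tower). Composing: the residual of record of crux 19076 (and of 20013 /
19075 / `N11.KimAtThreeDeepPUB`) is
  «leaves (`SakamotoKolyvaginThree`, `RankEqAnalyticRankLeOne`, `PoitouTateSelmerDuality`, `CarayolLevelEqConductor`)
   ∧ (S5a) `expStarCoord_eq_zero_iff_kummer` [cite] ∧ (S5b-tower) `exists_smul_range_expStarCoord_tower_iff_trace_log` [cite]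
   ∧ hKatoV2ᵘ [displayed: Kato-v2 over the DEFINED `Λ` / `exp*_ω`, kim3's hKatoV2₀ text minus stratum binders minus R-κ]».

* `definedKatoUniformThree_of_katoV2_of_facts` — item 20013 BY NAME;
* `deepUpperAtThree_of_katoV2_of_facts` — ★ crux 19076 `…Theses.KimAtThreeKolyvagin.DeepUpperAtThree` BY NAME;
* `deepLowerAtThree_of_katoV2_of_facts` — crux 19075 BY NAME; `kimAtThreeDeepPUB_of_katoV2_of_facts` — `N11.KimAtThreeDeepPUB`.

References: [Kato2004Asterisque] §9.4, Thm. 9.7, Thm. 12.5, Ex. 13.3; [Kato1993LNM1553] II Thm. 1.4.1; [BlochKato1990] §3;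
[Kim2025RefinedTNC] Thm. 1.1; [Sakamoto2024] Thm. 4.4; [MazurRubin2004] Thm. 5.2.12; [Carayol1986].
-/

noncomputable section

-- the cell's Theorems namespace `Summit.BirchSwinnertonDyer.BirchSwinnertonDyer.…` repeats the summit name by design (D-0017)
set_option linter.dupNamespace false

open scoped Classical NumberField TensorProduct ContRepresentation Pointwise
open Field ValuativeRel Function IsDedekindDomain NumberField
open WeierstrassCurve Literature.NumberTheory.EllipticCurves Literature.NumberTheory.GaloisRepresentations
  Literature.NumberTheory.GaloisRepresentations.DiscreteGaloisModule Literature.NumberTheory.GaloisCohomology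
open Literature.NumberTheory.GaloisRepresentations.PeriodRingData Literature.NumberTheory.PAdicHodge
open Literature.NumberTheory.EllipticCurves.ModularForms Literature.NumberTheory.EllipticCurves.Rank1Residual
open Literature.NumberTheory.EllipticCurves.Kato2004 Literature.NumberTheory.EllipticCurves.Kato2004.EulerSystemValues
open Literature.NumberTheory.AdelicBaseChange Literature.NumberTheory.Automorphic
open Summit.BirchSwinnertonDyer.Rank1Residual.GaloisImage
open Summit.BirchSwinnertonDyer.Rank1Residual.Additive
open Summit.BirchSwinnertonDyer.Rank1Residual.Additive.LocalLog
open Summit.BirchSwinnertonDyer.BirchSwinnertonDyer.Theses.KimAtThreeKolyvagin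
open Summit.BirchSwinnertonDyer.BirchSwinnertonDyer.Theorems
open Summit.BirchSwinnertonDyer.BirchSwinnertonDyer.Theorems.KimAtThreeFineKatoPerFactorDefined
open Summit.BirchSwinnertonDyer.BirchSwinnertonDyer.Theorems.KimAtThreeDeepLowerExpStarOmega
open Summit.BirchSwinnertonDyer.BirchSwinnertonDyer.Theorems.KimAtThreeDeepLowerExpStarOmegaPlace
open Summit.BirchSwinnertonDyer.BirchSwinnertonDyer.Theorems.KimAtThreeFineKatoPerFactorPlaces
open Summit.BirchSwinnertonDyer.BirchSwinnertonDyer.Theorems.KimAtThreeDeepLowerKatoPartsCrux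
open Summit.BirchSwinnertonDyer.BirchSwinnertonDyer.Theorems.KimAtThreeDeepUpperTowerLattice

namespace Summit.BirchSwinnertonDyer.BirchSwinnertonDyer.Theorems.KimAtThreeDeepUpperOfKatoV2

variable
    (hKatoV2 : ∀ (W : WeierstrassCurve ℚ) [W.IsElliptic] [W.IsGloballyMinimal]
      [ContinuousSMul ℤ_[3] (W.tateModule 3)] [Module.Free ℤ_[3] (W.tateModule 3)]
      [Module.Finite ℤ_[3] (W.tateModule 3)],
      (∀ m : ℕ, W.HasSurjectiveModNGaloisRep (3 ^ m : ℕ)) →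
      ∀ {N : ℕ} [NeZero N] (P : ModularParametrizationData W N), N = W.conductorNorm ℤ →
        (∀ z ∈ P.L.lattice, ∃ w ∈ periodLattice P.f, z = P.c * w) →
        haveI : Fact (((3 : ℕ) : 𝓞 ℚ) ∈ ((Rat.HeightOneSpectrum.primesEquiv (R := 𝓞 ℚ)).symm ⟨3, Fact.out⟩).asIdeal) :=
          ⟨(natCast_mem_asIdeal_iff_eq_primesEquiv_symm _ Nat.prime_three).mpr rfl⟩
        letI := valuativeRelPlace ((Rat.HeightOneSpectrum.primesEquiv (R := 𝓞 ℚ)).symm ⟨3, Fact.out⟩)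
        letI := topologicalSpacePlace ((Rat.HeightOneSpectrum.primesEquiv (R := 𝓞 ℚ)).symm ⟨3, Fact.out⟩)
        haveI := isNonarchimedeanLocalField_place ((Rat.HeightOneSpectrum.primesEquiv (R := 𝓞 ℚ)).symm ⟨3, Fact.out⟩)
        haveI := charZero_place ((Rat.HeightOneSpectrum.primesEquiv (R := 𝓞 ℚ)).symm ⟨3, Fact.out⟩)
        letI := padicAlgebraPlace 3 ((Rat.HeightOneSpectrum.primesEquiv (R := 𝓞 ℚ)).symm ⟨3, Fact.out⟩)
        haveI := fact_not_isUnit_place 3 ((Rat.HeightOneSpectrum.primesEquiv (R := 𝓞 ℚ)).symm ⟨3, Fact.out⟩)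
        haveI := isAdicComplete_place 3 ((Rat.HeightOneSpectrum.primesEquiv (R := 𝓞 ℚ)).symm ⟨3, Fact.out⟩)
        ∃ (d : LocalNeronLineAt W 3 ((Rat.HeightOneSpectrum.primesEquiv (R := 𝓞 ℚ)).symm ⟨3, Fact.out⟩))
          (hinj : (bdRPeriodRingData (valuation_place_lt_one 3 ((Rat.HeightOneSpectrum.primesEquiv (R := 𝓞 ℚ)).symm ⟨3, Fact.out⟩))).CupLogInjective (logCyclotomic 3)
            (localRationalTateRep W 3 (galRestrictPlace ((Rat.HeightOneSpectrum.primesEquiv (R := 𝓞 ℚ)).symm ⟨3, Fact.out⟩))))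
          (hex : ∀ z : contOneCocycles (localRationalTateRep W 3 (galRestrictPlace ((Rat.HeightOneSpectrum.primesEquiv (R := 𝓞 ℚ)).symm ⟨3, Fact.out⟩))).toTopRep,
            (bdRPeriodRingData (valuation_place_lt_one 3 ((Rat.HeightOneSpectrum.primesEquiv (R := 𝓞 ℚ)).symm ⟨3, Fact.out⟩))).HasDualExp (logCyclotomic 3)
              (localRationalTateRep W 3 (galRestrictPlace ((Rat.HeightOneSpectrum.primesEquiv (R := 𝓞 ℚ)).symm ⟨3, Fact.out⟩))) fun σ => z.1 σ),
          (∀ a : ℚ_[3], (∃ y, (expStarOmegaPadicAt d hinj hex (((Padic.adicCompletionEquiv (𝓞 ℚ) ⟨3, Fact.out⟩).symm : (((Rat.HeightOneSpectrum.primesEquiv (R := 𝓞 ℚ)).symm ⟨3, Fact.out⟩).adicCompletion ℚ) →+* ℚ_[3]))) y = a) ↔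
            ∀ Q : (W.baseChange ℚ_[3]).toAffine.Point, ‖a * padicLog (W.baseChange ℚ_[3]) Q‖ ≤ 1) ∧
        ∃ (ι : (n : ℕ) → (CyclotomicField n ℚ →+* ℂ)) (κK : ℝ)
          (Λ : ∀ (k' : ℕ) (r : Finset (HeightOneSpectrum (𝓞 ℚ))),
            H1 (tateRep W 3) (cycSubgroup 3 k' r) →ₗ[ℤ_[3]]
              ℚ_[3] ⊗[ℚ] CyclotomicField (cycLevel 3 k' r) ℚ),
          κK ≠ 0 ∧
          (∀ (j : ℕ) (r : Finset (HeightOneSpectrum (𝓞 ℚ)))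
            (Ψ : ℚ_[3] ⊗[ℚ] CyclotomicField (cycLevel 3 0 r) ℚ ≃ₐ[ℚ]
              (Π w : ((Rat.HeightOneSpectrum.primesEquiv (R := 𝓞 ℚ)).symm ⟨3, Fact.out⟩).Extension
                (𝓞 (CyclotomicField (cycLevel 3 0 r) ℚ)), w.1.adicCompletion (CyclotomicField (cycLevel 3 0 r) ℚ)))
            (hΨ : ∀ (s : ℚ_[3]) (x : CyclotomicField (cycLevel 3 0 r) ℚ)
              (w : ((Rat.HeightOneSpectrum.primesEquiv (R := 𝓞 ℚ)).symm ⟨3, Fact.out⟩).Extension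
                (𝓞 (CyclotomicField (cycLevel 3 0 r) ℚ))),
              Ψ (s ⊗ₜ[ℚ] x) w =
                algebraMap (CyclotomicField (cycLevel 3 0 r) ℚ) (w.1.adicCompletion (CyclotomicField (cycLevel 3 0 r) ℚ)) x *
                algebraMap (((Rat.HeightOneSpectrum.primesEquiv (R := 𝓞 ℚ)).symm ⟨3, Fact.out⟩).adicCompletion ℚ)
                  (w.1.adicCompletion (CyclotomicField (cycLevel 3 0 r) ℚ)) ((Padic.adicCompletionEquiv (𝓞 ℚ) ⟨3, Fact.out⟩) s)),
            ∃ (w₀ : ((Rat.HeightOneSpectrum.primesEquiv (R := 𝓞 ℚ)).symm ⟨3, Fact.out⟩).Extension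
                (𝓞 (CyclotomicField (cycLevel 3 0 r) ℚ)))
              (g : ((Rat.HeightOneSpectrum.primesEquiv (R := 𝓞 ℚ)).symm ⟨3, Fact.out⟩).Extension
                (𝓞 (CyclotomicField (cycLevel 3 0 r) ℚ)) → absoluteGaloisGroup ℚ)
              (hg : ∀ w : ((Rat.HeightOneSpectrum.primesEquiv (R := 𝓞 ℚ)).symm ⟨3, Fact.out⟩).Extension
                (𝓞 (CyclotomicField (cycLevel 3 0 r) ℚ)),
                sigma (cycLevel 3 0 r) (modNCyclotomicCharacter ℚ (cycLevel 3 0 r) (g w)) • w.1 = w₀.1),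
                letI := LocalField.charZero_adicCompletion w₀.1
                letI := LocalField.adicCompletionPadicAlgebra w₀.1 3 (three_mem_asIdeal_extension _ w₀)
                haveI : Fact (¬ IsUnit ((3 : ℕ) : integerC (w₀.1.adicCompletion (CyclotomicField (cycLevel 3 0 r) ℚ)))) :=
                  ⟨not_isUnit_natCast_integerC (LocalField.valuation_adicCompletion_natCast_lt_one w₀.1 3 (three_mem_asIdeal_extension _ w₀))⟩
                haveI := isAdicComplete_integerC_natCast (LocalField.valuation_adicCompletion_natCast_lt_one w₀.1 3 (three_mem_asIdeal_extension _ w₀))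
                ∃ (dw : LocalNeronLine W (LocalField.valuation_adicCompletion_natCast_lt_one w₀.1 3 (three_mem_asIdeal_extension _ w₀))
                  ((galRestrictPlace ((Rat.HeightOneSpectrum.primesEquiv (R := 𝓞 ℚ)).symm ⟨3, Fact.out⟩)).comp
                    (absGaloisRestrict (((Rat.HeightOneSpectrum.primesEquiv (R := 𝓞 ℚ)).symm ⟨3, Fact.out⟩).adicCompletion ℚ) (w₀.1.adicCompletion (CyclotomicField (cycLevel 3 0 r) ℚ)))))
                  (hinjw : (bdRPeriodRingData (LocalField.valuation_adicCompletion_natCast_lt_one w₀.1 3 (three_mem_asIdeal_extension _ w₀))).CupLogInjective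
                  (logCyclotomic 3) (localRationalTateRep W 3 ((galRestrictPlace ((Rat.HeightOneSpectrum.primesEquiv (R := 𝓞 ℚ)).symm ⟨3, Fact.out⟩)).comp
                    (absGaloisRestrict (((Rat.HeightOneSpectrum.primesEquiv (R := 𝓞 ℚ)).symm ⟨3, Fact.out⟩).adicCompletion ℚ) (w₀.1.adicCompletion (CyclotomicField (cycLevel 3 0 r) ℚ))))))
                  (hexw : ∀ z : contOneCocycles (localRationalTateRep W 3 ((galRestrictPlace ((Rat.HeightOneSpectrum.primesEquiv (R := 𝓞 ℚ)).symm ⟨3, Fact.out⟩)).comp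
                    (absGaloisRestrict (((Rat.HeightOneSpectrum.primesEquiv (R := 𝓞 ℚ)).symm ⟨3, Fact.out⟩).adicCompletion ℚ) (w₀.1.adicCompletion (CyclotomicField (cycLevel 3 0 r) ℚ))))).toTopRep,
                  (bdRPeriodRingData (LocalField.valuation_adicCompletion_natCast_lt_one w₀.1 3 (three_mem_asIdeal_extension _ w₀))).HasDualExp
                    (logCyclotomic 3) (localRationalTateRep W 3 ((galRestrictPlace ((Rat.HeightOneSpectrum.primesEquiv (R := 𝓞 ℚ)).symm ⟨3, Fact.out⟩)).comp
                    (absGaloisRestrict (((Rat.HeightOneSpectrum.primesEquiv (R := 𝓞 ℚ)).symm ⟨3, Fact.out⟩).adicCompletion ℚ) (w₀.1.adicCompletion (CyclotomicField (cycLevel 3 0 r) ℚ))))) fun σ => z.1 σ),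
                  (∀ (h : (tateLocalRep W 3 (Sum.inr ((Rat.HeightOneSpectrum.primesEquiv (R := 𝓞 ℚ)).symm ⟨3, Fact.out⟩))).cohomology 1),
                  (expStarOmegaHom (LocalField.valuation_adicCompletion_natCast_lt_one w₀.1 3 (three_mem_asIdeal_extension _ w₀))
                    ((galRestrictPlace ((Rat.HeightOneSpectrum.primesEquiv (R := 𝓞 ℚ)).symm ⟨3, Fact.out⟩)).comp
                    (absGaloisRestrict (((Rat.HeightOneSpectrum.primesEquiv (R := 𝓞 ℚ)).symm ⟨3, Fact.out⟩).adicCompletion ℚ) (w₀.1.adicCompletion (CyclotomicField (cycLevel 3 0 r) ℚ)))) dw hinjw hexw)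
                    (ContinuousRep.cohomologyRes (tateLocalRep W 3 (Sum.inr ((Rat.HeightOneSpectrum.primesEquiv (R := 𝓞 ℚ)).symm ⟨3, Fact.out⟩)))
                      (absGaloisRestrict (((Rat.HeightOneSpectrum.primesEquiv (R := 𝓞 ℚ)).symm ⟨3, Fact.out⟩).adicCompletion ℚ) (w₀.1.adicCompletion (CyclotomicField (cycLevel 3 0 r) ℚ))) 1 h) =
                  algebraMap (((Rat.HeightOneSpectrum.primesEquiv (R := 𝓞 ℚ)).symm ⟨3, Fact.out⟩).adicCompletion ℚ) (w₀.1.adicCompletion (CyclotomicField (cycLevel 3 0 r) ℚ)) (expStarOmegaAt d h)) ∧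
                  (∀ (w : ((Rat.HeightOneSpectrum.primesEquiv (R := 𝓞 ℚ)).symm ⟨3, Fact.out⟩).Extension
                    (𝓞 (CyclotomicField (cycLevel 3 0 r) ℚ)))
                  (y : H1 (tateRep W 3) (cycSubgroup 3 0 r))
                  (φ'' : contOneCocycles (subgroupRep (tateRep W 3).toTopRep (cycSubgroup 3 0 r)))
                  (ψT : contOneCocycles ((tateLocalRep W 3 (Sum.inr ((Rat.HeightOneSpectrum.primesEquiv (R := 𝓞 ℚ)).symm ⟨3, Fact.out⟩))).restrict
                    (absGaloisRestrict (((Rat.HeightOneSpectrum.primesEquiv (R := 𝓞 ℚ)).symm ⟨3, Fact.out⟩).adicCompletion ℚ) (w₀.1.adicCompletion (CyclotomicField (cycLevel 3 0 r) ℚ)))).toTopRep),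
                  oneCocycleClass _ φ'' = conjMap (tateRep W 3).toTopRep (cycSubgroup 3 0 r) (g w) 1 y →
                  (∀ σ, ψT.1 σ = φ''.1 ⟨absGaloisRestrictTower ℚ (((Rat.HeightOneSpectrum.primesEquiv (R := 𝓞 ℚ)).symm ⟨3, Fact.out⟩).adicCompletion ℚ) (w₀.1.adicCompletion (CyclotomicField (cycLevel 3 0 r) ℚ)) σ,
                    absGaloisRestrictTower_adicCompletion_mem_cycSubgroup r w₀ σ⟩) →
                  Ψ (Λ 0 r y) w = galAdicCompletionMap
                    (sigma (cycLevel 3 0 r) (modNCyclotomicCharacter ℚ (cycLevel 3 0 r) (g w)))⁻¹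
                    (inv_smul_eq_of_smul_eq (hg w))
                    ((expStarOmegaHom (LocalField.valuation_adicCompletion_natCast_lt_one w₀.1 3 (three_mem_asIdeal_extension _ w₀))
                    ((galRestrictPlace ((Rat.HeightOneSpectrum.primesEquiv (R := 𝓞 ℚ)).symm ⟨3, Fact.out⟩)).comp
                    (absGaloisRestrict (((Rat.HeightOneSpectrum.primesEquiv (R := 𝓞 ℚ)).symm ⟨3, Fact.out⟩).adicCompletion ℚ) (w₀.1.adicCompletion (CyclotomicField (cycLevel 3 0 r) ℚ)))) dw hinjw hexw) (oneCocycleClass _ ψT)))) ∧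
          ∀ (c d a : ℤ) (A : ℕ), 0 < A → Int.gcd c (6 * 3 * A) = 1 → Int.gcd d (6 * 3 * N) = 1 →
            ∃ (z : ∀ (k' : ℕ) (r : (cyclotomicLevelsRat 3 (badPlaces c d A N)).Ideals),
                  H1 (tateRep W 3) ((cyclotomicLevelsRat 3 (badPlaces c d A N)).level k' r.1))
              (x : ∀ (k' : ℕ) (r : (cyclotomicLevelsRat 3 (badPlaces c d A N)).Ideals),
                  CyclotomicField (cycLevel 3 k' r.1) ℚ),
              ZetaBody W 3 P.f ι κK Λ c d a A z x)

variable (hSak : SakamotoKolyvaginThree) (hGZK : RankEqAnalyticRankLeOne) (hPT : PoitouTateSelmerDuality)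

include hKatoV2 in
/-- **Item `DefinedKatoUniformThree` (20013) BY NAME from (S5a), (S5b-tower) and hKatoV2ᵘ** (hLatᵘ discharged by
`hLat_of_facts`). Conditional. [cite: Kato2004Asterisque, §9.4 and Thm. 9.7 (pp. 188–189)] [cite: Kato1993LNM1553, Ch. II Thm. 1.4.1 (3)–(4)] [cite: BlochKato1990, §3 (Prop. 3.8, Ex. 3.11)] -/
theorem definedKatoUniformThree_of_katoV2_of_facts (hS : expStarCoord_eq_zero_iff_kummer)
    (hT₂ : exists_smul_range_expStarCoord_tower_iff_trace_log) : DefinedKatoUniformThree :=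
  definedKatoUniformThree_holds_of_katoParts hKatoV2 (hLat_of_facts hT₂) hS

include hKatoV2 hSak hGZK hPT in
/-- ★ **Crux `DeepUpperAtThree` (19076) BY NAME** from the four leaves, (S5a), (S5b-tower) and hKatoV2ᵘ. Conditional;
nothing booked. [cite: Kim2025RefinedTNC, Thm 1.1] [cite: Sakamoto2024, Thm. 4.4 (1)(2) (p. 926)] [cite: Carayol1986]
[cite: Kato2004Asterisque, §9.4 and Thm. 9.7 (pp. 188–189)] [cite: Kato1993LNM1553, Ch. II Thm. 1.4.1 (3)–(4)] -/
theorem deepUpperAtThree_of_katoV2_of_facts (hS : expStarCoord_eq_zero_iff_kummer)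
    (hT₂ : exists_smul_range_expStarCoord_tower_iff_trace_log) (hlev : CarayolLevelEqConductor) :
    Summit.BirchSwinnertonDyer.BirchSwinnertonDyer.Theses.KimAtThreeKolyvagin.DeepUpperAtThree :=
  (deepLower_and_deepUpper_of_katoParts hKatoV2 (hLat_of_facts hT₂) hSak hGZK hPT hS hlev).2

include hKatoV2 hSak hGZK hPT in
/-- **Crux `DeepLowerAtThree` (19075) BY NAME** from the four leaves, (S5a), (S5b-tower) and hKatoV2ᵘ. Conditional.
[cite: Kim2025RefinedTNC, Thm 1.1] [cite: Sakamoto2024, Thm. 4.4 (1)(2) (p. 926)] [cite: Kato2004Asterisque, §9.4 and Thm. 9.7 (pp. 188–189)] -/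
theorem deepLowerAtThree_of_katoV2_of_facts (hS : expStarCoord_eq_zero_iff_kummer)
    (hT₂ : exists_smul_range_expStarCoord_tower_iff_trace_log) (hlev : CarayolLevelEqConductor) :
    Summit.BirchSwinnertonDyer.BirchSwinnertonDyer.Theses.KimAtThreeKolyvagin.DeepLowerAtThree :=
  deepLowerAtThree_of_katoParts hKatoV2 (hLat_of_facts hT₂) hSak hGZK hPT hS hlev

include hKatoV2 hSak hGZK hPT in
/-- ★★ **`N11.KimAtThreeDeepPUB` BY NAME** from the four leaves, (S5a), (S5b-tower) and hKatoV2ᵘ. Conditional; nothing booked.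
[cite: Kim2025RefinedTNC, Thm 1.1] [cite: Kim2022StructureSelmer, Thm. 1.9 (6), Thm. 3.13] [cite: Kato2004Asterisque, §9.4 and Thm. 9.7 (pp. 188–189)] -/
theorem kimAtThreeDeepPUB_of_katoV2_of_facts (hS : expStarCoord_eq_zero_iff_kummer)
    (hT₂ : exists_smul_range_expStarCoord_tower_iff_trace_log) (hlev : CarayolLevelEqConductor) :
    N11.KimAtThreeDeepPUB :=
  kimAtThreeDeepPUB_of_katoParts hKatoV2 (hLat_of_facts hT₂) hSak hGZK hPT hS hlev

end Summit.BirchSwinnertonDyer.BirchSwinnertonDyer.Theorems.KimAtThreeDeepUpperOfKatoV2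

end
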